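import Mathlib.RingTheory.UniqueFactorizationDomain.Multiplicity
import Mathlib.RingTheory.Localization.FractionRing
import Mathlib.Tactic.LinearCombination
import HarnessLib

/-!
# A unit `ε ≡ ±3 (mod 𝔭³)` at a dyadic prime `𝔭` with `e(𝔭|2) = f(𝔭|2) = 1` is NOT of the form `x² − 2y²`
# (the elementary half of «the dyadic Hilbert symbol `(ε, 2)_𝔭 = −1`», Serre's `(2, u) = (−1)^{ω(u)}`)

Topic `NumberTheory/NumberFields` (namespace = path).  THEOREM-ONLY file (no definition, no named fact, no instance, no `sorry`),
written by the prover seat `bsd-2adic-k4-w1` GEN 10 (cell `bsd-2adic`; `--supports` stmt-BirchSwinnertonDyer-22615: the non-norm unit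
input of the genus-theory parity lemma for `F(√2)/F`, `F = ℚ(P)` the totally real cubic point field of the census row `445508b1`).

Purely ring-theoretic statements.  Let `R` be an integral domain in which divisibility is well-founded (any noetherian domain, e.g. the
integers of a number field), `π ∈ R` a PRIME element with `2 = π·w`, `π ∤ w` («`e = 1`») and `R/(π) = {0, 1}` («`f = 1`»; hypothesis
`∀ t, π ∣ t ∨ π ∣ t − 1`).  Then (`sq_sub_one_of_not_dvd`) every `π`-unit `a` has `a² ≡ 1 (mod π³)` — the local ring is `ℤ₂`-like:
`(1 + πt)² = 1 + π²t(t + w)` and `t(t + w) ≡ t(t + 1) ≡ 0` —, so (`dvd_sub_one_or_dvd_add_one_of_sq_sub_two_mul_sq`) an identity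
`a² − 2b² = c²ε`, `c ≠ 0`, forces `ε ≡ 1` or `ε ≡ −1 (mod π³)` (descent on the power of `π` in `c`: if `π ∣ c` then `π ∣ a`, `π ∣ b`,
and `π²` cancels; if `π ∤ c` then `ε ≡ a² − 2b² ≡ 1 − 2b² ∈ {1, −1}`).  Hence (`not_exists_sq_sub_two_mul_sq_of_dvd_sub_three`,
`…_of_dvd_add_three`) a unit `ε ≡ 3` or `ε ≡ −3 (mod π³)` is not `x² − 2y²` with `x, y` in the fraction field
(`not_exists_sq_sub_two_mul_sq_fractionRing_…`): in Hilbert-symbol language `(ε, 2)_𝔭 = −1`, Serre's formula `(2, u) = (−1)^{ω(u)}`,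
`ω(u) = (u² − 1)/8`, for `ℚ₂`; here only the elementary direction «`u ≡ ±3 (mod 8)` ⟹ not a norm from `ℚ₂(√2)`» is proved, and
without completions.  The consumer takes `R = 𝓞_F`, `π` a generator of a principal dyadic prime of degree one unramified over `2`, and
a unit `ε` whose residue mod `π³` is `3`: then `ε ∉ N_{F(√2)/F}(F(√2)^×)`, the non-norm unit that makes the unit index of Chevalley's
ambiguous class number formula even.

References: [Serre1973CourseArithmetic] Ch. III §1.2, Thm. 1 (the symbol `(2, u)` over `ℚ₂`) and Ch. II §3.3 (squares in `ℚ₂`);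
[Omeara1963] §63B (63:10) (norms from `K(√θ)` are the `x² − θy²`); [NeukirchANT1999] Ch. V §3 (Hilbert symbol at dyadic places).
-/

namespace Literature.NumberTheory.NumberFields

variable {R : Type*} [CommRing R]

section Residue

variable [IsDomain R] {π w : R}

omit [IsDomain R] in
/-- If `R/(π) = {0,1}` and `π ∤ w` with `2 = πw`, then `π ∣ w − 1`. [cite: Serre1973CourseArithmetic, Ch. II §3.3 (units of `ℤ₂`)] -/
private theorem dvd_sub_one_of_not_dvd (hres : ∀ t : R, π ∣ t ∨ π ∣ t - 1) {a : R} (ha : ¬ π ∣ a) : π ∣ a - 1 :=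
  (hres a).resolve_left ha

omit [IsDomain R] in
/-- **`a² ≡ 1 (mod π³)` for every `π`-unit `a`**, when `2 = πw`, `π ∤ w` and `R/(π) = {0, 1}`: `a = 1 + πt`,
`a² − 1 = π²·t(t + w)` and `π ∣ t(t + w)` (`t ≡ 0` or `t ≡ 1 ≡ −w`).  (The structure of the squares of `ℤ₂^×`: `1 + 8ℤ₂`.)
[cite: Serre1973CourseArithmetic, Ch. II §3.3, Thm. 4 (squares in `ℚ₂^×`)] -/
theorem pow_three_dvd_sq_sub_one_of_not_dvd (h2 : (2 : R) = π * w) (hw : ¬ π ∣ w)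
    (hres : ∀ t : R, π ∣ t ∨ π ∣ t - 1) {a : R} (ha : ¬ π ∣ a) : π ^ 3 ∣ a ^ 2 - 1 := by
  obtain ⟨t, ht⟩ := dvd_sub_one_of_not_dvd hres ha
  have ha' : a = 1 + π * t := by linear_combination ht
  have hw1 : π ∣ w - 1 := dvd_sub_one_of_not_dvd hres hw
  -- `π ∣ t (t + w)`
  have htt : π ∣ t * (t + w) := by
    rcases hres t with h | h
    · exact h.mul_right _
    · obtain ⟨s, hs⟩ := h
      obtain ⟨v, hv⟩ := hw1
      refine ⟨t * (s + v + w), ?_⟩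
      have : t + w = π * (s + v) + 2 := by linear_combination hs + hv
      rw [this, h2]; ring
  obtain ⟨q, hq⟩ := htt
  exact ⟨q, by rw [ha']; linear_combination (π * t) * h2 + π ^ 2 * hq⟩

end Residue

section Descent

variable [IsDomain R] [WfDvdMonoid R] {π w ε : R}

/-- **Descent: `a² − 2b² = c²ε` with `c ≠ 0` forces `ε ≡ ±1 (mod π³)`** (`π` prime, `2 = πw`, `π ∤ w`, `R/(π) = {0,1}`, `π ∤ ε`).
If `π ∣ c` then `π ∣ a² = 2b² + c²ε`, so `π ∣ a`, then `π·w b² ∈ (π²)` gives `π ∣ b`, and `π²` cancels (induction on the exact power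
of `π` in `c`, which exists as divisibility is well-founded); if `π ∤ c` then `a`, `c` are `π`-units, `a² ≡ c² ≡ 1 (mod π³)`, and
`c²ε ≡ ε ≡ 1 − 2b² ≡ 1` or `−1` according as `π ∣ b` or not. [cite: Serre1973CourseArithmetic, Ch. III §1.2, Thm. 1 (proof)] -/
theorem pow_three_dvd_sub_one_or_add_one_of_sq_sub_two_mul_sq (hπ : Prime π) (h2 : (2 : R) = π * w) (hw : ¬ π ∣ w)
    (hres : ∀ t : R, π ∣ t ∨ π ∣ t - 1) (hε : ¬ π ∣ ε) {a b c : R} (hc : c ≠ 0) (h : a ^ 2 - 2 * b ^ 2 = c ^ 2 * ε) :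
    π ^ 3 ∣ ε - 1 ∨ π ^ 3 ∣ ε + 1 := by
  obtain ⟨k, c', hc', rfl⟩ := WfDvdMonoid.max_power_factor' hc hπ.not_unit
  induction k generalizing a b with
  | zero =>
    rw [pow_zero, one_mul] at h
    -- `π ∤ a`
    have ha : ¬ π ∣ a := by
      intro hpa
      have h1 : π ∣ c' ^ 2 * ε := by
        rw [← h, h2]
        exact dvd_sub (dvd_pow hpa two_ne_zero) (Dvd.intro (w * b ^ 2) (by ring))
      rcases hπ.dvd_or_dvd h1 with h3 | h3
      · exact hc' (hπ.dvd_of_dvd_pow h3)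
      · exact hε h3
    have hsa := pow_three_dvd_sq_sub_one_of_not_dvd h2 hw hres ha
    have hsc := pow_three_dvd_sq_sub_one_of_not_dvd h2 hw hres hc'
    -- `c'² ε ≡ ε`
    have hce : π ^ 3 ∣ c' ^ 2 * ε - ε := by
      obtain ⟨q, hq⟩ := hsc
      exact ⟨q * ε, by linear_combination ε * hq⟩
    rcases hres b with hb | hb
    · -- `π ∣ b`: `2b² ∈ (π³)`, so `ε ≡ a² ≡ 1`
      left
      obtain ⟨b', hb'⟩ := hb
      obtain ⟨q, hq⟩ := hsa
      obtain ⟨r, hr⟩ := hce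
      refine ⟨q - w * b' ^ 2 - r, ?_⟩
      linear_combination (-1 : R) * h + hq - hr + (-2 * (b + π * b')) * hb' + (-(π ^ 2 * b' ^ 2)) * h2
    · -- `π ∤ b`: `2b² ≡ 2`, so `ε ≡ a² − 2b² ≡ −1`
      right
      have hb' : ¬ π ∣ b := by
        intro hpb
        obtain ⟨s, hs⟩ := hb
        obtain ⟨s', hs'⟩ := hpb
        have h1 : (1 : R) = π * (s' - s) := by linear_combination hs' - hs
        exact hπ.not_unit (IsUnit.of_mul_eq_one (s' - s) h1.symm)
      obtain ⟨q, hq⟩ := hsa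
      obtain ⟨p, hp⟩ := pow_three_dvd_sq_sub_one_of_not_dvd h2 hw hres hb'
      obtain ⟨r, hr⟩ := hce
      refine ⟨q - 2 * p - r, ?_⟩
      linear_combination (-1 : R) * h + hq - 2 * hp - hr
  | succ k ih =>
    -- `π ∣ a`
    have hpa : π ∣ a := by
      have h1 : π ∣ a ^ 2 := by
        have : a ^ 2 = π * (w * b ^ 2 + π ^ (2 * k + 1) * c' ^ 2 * ε) := by
          linear_combination h + b ^ 2 * h2
        exact ⟨_, this⟩
      exact hπ.dvd_of_dvd_pow h1
    obtain ⟨a', rfl⟩ := hpa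
    -- `π ∣ b`
    have hpb : π ∣ b := by
      have h1 : π ∣ w * b ^ 2 := by
        refine ⟨a' ^ 2 - π ^ (2 * k) * c' ^ 2 * ε, ?_⟩
        have h3 : π * (w * b ^ 2) = π * (π * (a' ^ 2 - π ^ (2 * k) * c' ^ 2 * ε)) := by
          linear_combination (-1 : R) * h + (-(b ^ 2)) * h2
        exact mul_left_cancel₀ hπ.ne_zero h3
      rcases hπ.dvd_or_dvd h1 with h3 | h3
      · exact absurd h3 hw
      · exact hπ.dvd_of_dvd_pow h3
    obtain ⟨b', rfl⟩ := hpb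
    refine ih (a := a') (b := b') (mul_ne_zero (pow_ne_zero _ hπ.ne_zero) (right_ne_zero_of_mul hc)) ?_
    have h3 : π ^ 2 * (a' ^ 2 - 2 * b' ^ 2) = π ^ 2 * ((π ^ k * c') ^ 2 * ε) := by linear_combination h
    exact mul_left_cancel₀ (pow_ne_zero 2 hπ.ne_zero) h3

omit [IsDomain R] [WfDvdMonoid R] in
/-- `π ∤ ε` when `π³ ∣ ε − 3` or `π³ ∣ ε + 3` (`2 = πw`: `π ∣ 3` would give `π ∣ 1`). [folklore] -/
private theorem not_dvd_of_pow_three_dvd (hπ : Prime π) (h2 : (2 : R) = π * w) {δ : R} (hδ : δ = 3 ∨ δ = -3)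
    (h3 : π ^ 3 ∣ ε - δ) : ¬ π ∣ ε := by
  intro hε
  have h1 : π ∣ ε - δ := (dvd_pow_self π (by norm_num)).trans h3
  have h3' : π ∣ δ := by
    have := dvd_sub hε h1
    rwa [sub_sub_cancel] at this
  have hone : π ∣ (1 : R) := by
    rcases hδ with rfl | rfl
    · have : (1 : R) = 3 - π * w := by linear_combination -h2
      rw [this]; exact dvd_sub h3' (dvd_mul_right π w)
    · have : (1 : R) = -(-3) - π * w := by linear_combination -h2
      rw [this]; exact dvd_sub (dvd_neg.mpr h3') (dvd_mul_right π w)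
  exact hπ.not_unit (isUnit_of_dvd_one hone)

omit [WfDvdMonoid R] in
/-- `π³ ∤ 2` and `π³ ∤ 4` (`2 = πw`, `π ∤ w`). [folklore] -/
private theorem not_pow_three_dvd_two_four (hπ : Prime π) (h2 : (2 : R) = π * w) (hw : ¬ π ∣ w) :
    ¬ π ^ 3 ∣ (2 : R) ∧ ¬ π ^ 3 ∣ (4 : R) := by
  constructor
  · rintro ⟨q, hq⟩
    apply hw
    refine ⟨π * q, mul_left_cancel₀ hπ.ne_zero ?_⟩
    linear_combination -h2 + hq
  · rintro ⟨q, hq⟩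
    have h1 : w ^ 2 = π * q := by
      apply mul_left_cancel₀ (pow_ne_zero 2 hπ.ne_zero)
      linear_combination (-(π * w) - 2) * h2 + hq
    have h3 : π ∣ w ^ 2 := ⟨q, h1⟩
    exact hw (hπ.dvd_of_dvd_pow h3)

/-- **A unit `ε ≡ 3 (mod π³)` is not `a²−2b²` up to squares: no `a, b, c ∈ R`, `c ≠ 0`, with `a² − 2b² = c²ε`** (`π` prime,
`2 = πw`, `π ∤ w`, `R/(π) = {0,1}`): by the descent `ε ≡ ±1`, but `3 − 1 = 2 = πw` and `3 + 1 = 4 = π²w²` are not in `(π³)`.  This is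
«`(ε, 2)_𝔭 = −1` for `ε ≡ 3 (mod 8)`» at an unramified dyadic prime of degree one. [cite: Serre1973CourseArithmetic, Ch. III §1.2, Thm. 1]
[cite: Omeara1963, §63B (63:10)] -/
theorem not_exists_sq_sub_two_mul_sq_of_pow_three_dvd_sub_three (hπ : Prime π) (h2 : (2 : R) = π * w) (hw : ¬ π ∣ w)
    (hres : ∀ t : R, π ∣ t ∨ π ∣ t - 1) (h3 : π ^ 3 ∣ ε - 3) :
    ¬ ∃ a b c : R, c ≠ 0 ∧ a ^ 2 - 2 * b ^ 2 = c ^ 2 * ε := by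
  rintro ⟨a, b, c, hc, h⟩
  have hε := not_dvd_of_pow_three_dvd hπ h2 (Or.inl rfl) h3
  obtain ⟨h2', h4'⟩ := not_pow_three_dvd_two_four hπ h2 hw
  rcases pow_three_dvd_sub_one_or_add_one_of_sq_sub_two_mul_sq hπ h2 hw hres hε hc h with h1 | h1
  · apply h2'
    have := dvd_sub h1 h3
    rwa [show ε - 1 - (ε - 3) = (2 : R) by ring] at this
  · apply h4'
    have := dvd_sub h1 h3
    rwa [show ε + 1 - (ε - 3) = (4 : R) by ring] at this

/-- **A unit `ε ≡ −3 (mod π³)` is not `a²−2b²` up to squares** («`(ε, 2)_𝔭 = −1` for `ε ≡ 5 (mod 8)`»).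
[cite: Serre1973CourseArithmetic, Ch. III §1.2, Thm. 1] [cite: Omeara1963, §63B (63:10)] -/
theorem not_exists_sq_sub_two_mul_sq_of_pow_three_dvd_add_three (hπ : Prime π) (h2 : (2 : R) = π * w) (hw : ¬ π ∣ w)
    (hres : ∀ t : R, π ∣ t ∨ π ∣ t - 1) (h3 : π ^ 3 ∣ ε + 3) :
    ¬ ∃ a b c : R, c ≠ 0 ∧ a ^ 2 - 2 * b ^ 2 = c ^ 2 * ε := by
  rintro ⟨a, b, c, hc, h⟩
  have hε := not_dvd_of_pow_three_dvd hπ h2 (Or.inr rfl) (by rwa [sub_neg_eq_add])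
  obtain ⟨h2', h4'⟩ := not_pow_three_dvd_two_four hπ h2 hw
  rcases pow_three_dvd_sub_one_or_add_one_of_sq_sub_two_mul_sq hπ h2 hw hres hε hc h with h1 | h1
  · apply h4'
    have := dvd_sub h3 h1
    rwa [show ε + 3 - (ε - 1) = (4 : R) by ring] at this
  · apply h2'
    have := dvd_sub h3 h1
    rwa [show ε + 3 - (ε + 1) = (2 : R) by ring] at this

end Descent

section Field

variable [IsDomain R] [WfDvdMonoid R] {π w ε : R} (K : Type*) [Field K] [Algebra R K] [IsFractionRing R K]

omit [WfDvdMonoid R] in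
/-- Clearing denominators: `x² − 2y² = ε` in the fraction field gives `a² − 2b² = c²ε` in `R` with `c ≠ 0`. [folklore] -/
private theorem exists_sq_sub_two_mul_sq_of_field {x y : K} (h : x ^ 2 - 2 * y ^ 2 = algebraMap R K ε) :
    ∃ a b c : R, c ≠ 0 ∧ a ^ 2 - 2 * b ^ 2 = c ^ 2 * ε := by
  obtain ⟨a₁, d₁, hd₁, hx⟩ := IsFractionRing.div_surjective (A := R) x
  obtain ⟨a₂, d₂, hd₂, hy⟩ := IsFractionRing.div_surjective (A := R) y
  have hd₁0 : d₁ ≠ 0 := nonZeroDivisors.ne_zero hd₁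
  have hd₂0 : d₂ ≠ 0 := nonZeroDivisors.ne_zero hd₂
  have hd₁K : algebraMap R K d₁ ≠ 0 := IsFractionRing.to_map_ne_zero_of_mem_nonZeroDivisors hd₁
  have hd₂K : algebraMap R K d₂ ≠ 0 := IsFractionRing.to_map_ne_zero_of_mem_nonZeroDivisors hd₂
  refine ⟨a₁ * d₂, a₂ * d₁, d₁ * d₂, mul_ne_zero hd₁0 hd₂0, ?_⟩
  have hx' : algebraMap R K a₁ = x * algebraMap R K d₁ := by rw [← hx, div_mul_cancel₀ _ hd₁K]
  have hy' : algebraMap R K a₂ = y * algebraMap R K d₂ := by rw [← hy, div_mul_cancel₀ _ hd₂K]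
  apply IsFractionRing.injective R K
  simp only [map_sub, map_mul, map_pow, map_ofNat]
  rw [hx', hy']
  linear_combination (algebraMap R K d₁ * algebraMap R K d₂) ^ 2 * h

/-- **Field form: a unit `ε ≡ 3 (mod π³)` of `R` is not of the form `x² − 2y²` with `x, y` in the fraction field `K` of `R`** —
`ε` is not a norm from `K(√2)` (O'Meara 63:10: the norms from `K(√θ)` are the values `x² − θy²`); the dyadic obstruction
`(ε, 2)_𝔭 = −1`. [cite: Serre1973CourseArithmetic, Ch. III §1.2, Thm. 1] [cite: Omeara1963, §63B (63:10)] -/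
theorem not_exists_sq_sub_two_mul_sq_fractionRing_of_pow_three_dvd_sub_three (hπ : Prime π) (h2 : (2 : R) = π * w)
    (hw : ¬ π ∣ w) (hres : ∀ t : R, π ∣ t ∨ π ∣ t - 1) (h3 : π ^ 3 ∣ ε - 3) :
    ¬ ∃ x y : K, x ^ 2 - 2 * y ^ 2 = algebraMap R K ε := by
  rintro ⟨x, y, h⟩
  exact not_exists_sq_sub_two_mul_sq_of_pow_three_dvd_sub_three hπ h2 hw hres h3 (exists_sq_sub_two_mul_sq_of_field K h)

/-- **Field form, `ε ≡ −3 (mod π³)`**: `ε` is not `x² − 2y²` with `x, y ∈ K = Frac R`. [cite: Serre1973CourseArithmetic, Ch. III §1.2, Thm. 1]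
[cite: Omeara1963, §63B (63:10)] -/
theorem not_exists_sq_sub_two_mul_sq_fractionRing_of_pow_three_dvd_add_three (hπ : Prime π) (h2 : (2 : R) = π * w)
    (hw : ¬ π ∣ w) (hres : ∀ t : R, π ∣ t ∨ π ∣ t - 1) (h3 : π ^ 3 ∣ ε + 3) :
    ¬ ∃ x y : K, x ^ 2 - 2 * y ^ 2 = algebraMap R K ε := by
  rintro ⟨x, y, h⟩
  exact not_exists_sq_sub_two_mul_sq_of_pow_three_dvd_add_three hπ h2 hw hres h3 (exists_sq_sub_two_mul_sq_of_field K h)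

end Field

end Literature.NumberTheory.NumberFields
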